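import Summits.RiemannHypothesis.RiemannHypothesis.Theorems.Splittings.LinearRayLehmerWindowLowDefs

/-!
# The linear-factor ray at Lehmer's pair — compiled certificate 4/4: forward averages, `2/5 ≤ a ≤ 1`

Cell rh-split (D-0116 arm), ENGINE 5 (rh-splitx-eng-5 g4), lane (xviii-D) «LEHMER WINDOW DATA», ADDENDUM.
The sub-unity forward-average check `ldQRunL 10 50 ldAsSub 1000 9 250 219000` (forward point data
`hiPointData C 10 0 50`, 800 certified `ζ` evaluations; boxes `ldAsSub/1000 = [2/5, 1/2, …, 1]`; decay-aware
tail; per box the margin `(9/250)·219000 < e^{−a₂·9/250}·q`) — evaluated ONCE by `native_decide`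
(declared computational axiom `ldSub_check`).  Design numbers (`K₀`-free units): `q = 9.8·10⁷` (box
`[2/5, 1/2]`, tail `2.0·10⁷`) … `6.2·10⁷` (box `[9/10, 1]`, tail `547`) against `L·M = 7884`; the box
`[3/10, 2/5]` would fail (tail `1.7·10⁸`).  Soundness: `ldQRunWithL_sound` (`LinearRayLehmerWindowLowQ.lean`).
HONEST LABEL: RH-free negative-side bookkeeping on the linear-factor ray; nothing here bears on the truth of RH.
-/

set_option linter.dupNamespace false

namespace Summit.RiemannHypothesis.RiemannHypothesis.Theorems.Splittings.LinearRayLehmerWindow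

/-- **The compiled forward-average check, sub-unity window** (`native_decide`). [folklore] -/
theorem ldSub_check : ldQRunL 10 50 ldAsSub 1000 9 250 219000 = true := by
  native_decide

end Summit.RiemannHypothesis.RiemannHypothesis.Theorems.Splittings.LinearRayLehmerWindow
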